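import Mathlib
import HarnessLib
import Literature.Probability.LatticeModels.RandomClusterGhostConnection
import Literature.Probability.LatticeModels.CriticalFKIsingArmVanishes

/-!
# The thermodynamic limit of the critical FK-Ising connection laws along translated boxes

Topic `Literature/Probability/LatticeModels`. For the wired FK-Ising random-cluster measure at
`p = 1 - e^{-2β_c(d)}`, `q = 2`, `d ≥ 3`, of the translated boxes `Λ_L + v` of `ℤ^d`, and finitely many
probe sets `K i ⊆ ℤ^d` each finite or co-finite, the law of the OPEN-PATH CONNECTION RELATION among
the probes (`i ~ j` iff some `x ∈ K i`, `y ∈ K j` in the box are joined by an open path of the box, no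
wiring) converges as `L → ∞`, to a limit that does not depend on `v`
(`tendsto_rcMeasure_real_connRelLaw_criticalBeta`):

* `ghostConnEvent_diff_connEvent_subset` — if two probes are joined through the wired boundary but not
  by an open path, some lattice point of `Λ_r` is joined to the boundary by an open path (finite
  probes lie in `Λ_r`, co-finite probes contain the boundary of a large box), so the ghost correction
  is bounded by finitely many arm probabilities, which vanish (`CriticalFKIsingArmVanishes`);
* `tendsto_rcMeasure_real_connEvent_criticalBeta` — hence the open-path connection events converge
  (`RandomClusterGhostConnection` gives the ghost-wired limit);
* `tendsto_rcMeasure_real_connAtom_criticalBeta`, `measureReal_connRelLaw_eq_sum` — the atoms of the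
  relation and the law of the relation follow by finite additivity (induction on the number of
  excluded pairs; `{relation ∈ R}` is the disjoint union of the atoms of the admissible patterns).

This is the finite-volume content of Grimmett 2006, Thm. (4.19)(b)–(c) (existence and automorphism
invariance of the wired limit measure) for connection events at `p_c(2)` on `ℤ^d`, `d ≥ 3`, where the
wired arm correction vanishes by `m*(β_c) = 0`. Used by the route
`CriticalPhenomena/Ising3DConformalLimit/ArmDressing` (crux `BallConnectivityMoebius`).

## References

* G. Grimmett, *The Random-Cluster Model* (2006), Thm. (4.19) and its proof. [Grimmett2006]
* M. Aizenman, H. Duminil-Copin, V. Sidoravicius, Comm. Math. Phys. 334 (2015), Thm. 1.2.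
  [AizenmanDuminilCopinSidoraviciusCMP2015]
-/

noncomputable section

namespace Literature.Probability.LatticeModels

open _root_.MeasureTheory Finset SimpleGraph Filter _root_.Topology
open Literature.Probability.Percolation

/-! ### Paths through the wiring: the first and the last wired step -/

section Wiring

variable {W : Type*} {ω : BondConfig W} {B : Set W}

/-- A path of open edges and wired pairs either is an open path or reaches the wired set by an
open path (cut at the first wired step). [folklore] -/
theorem reachable_or_exists_mem_wired {u v : W} (h : (openGraph ω ⊔ wired B).Reachable u v) :
    (openGraph ω).Reachable u v ∨ ∃ b ∈ B, (openGraph ω).Reachable u b := by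
  obtain ⟨p⟩ := h
  induction p with
  | nil => exact Or.inl (Reachable.refl _)
  | @cons u' w _ hadj _ ih =>
    rw [sup_adj] at hadj
    rcases hadj with hadj | hadj
    · rcases ih with h' | ⟨b, hb, hwb⟩
      · exact Or.inl (hadj.reachable.trans h')
      · exact Or.inr ⟨b, hb, hadj.reachable.trans hwb⟩
    · rw [wired_adj] at hadj
      exact Or.inr ⟨u', hadj.2.1, Reachable.refl _⟩

/-- Dually: an open path, or an open path from the wired set to the endpoint (cut at the last
wired step). [folklore] -/
theorem reachable_or_exists_mem_wired' {u v : W} (h : (openGraph ω ⊔ wired B).Reachable u v) :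
    (openGraph ω).Reachable u v ∨ ∃ b ∈ B, (openGraph ω).Reachable b v := by
  rcases reachable_or_exists_mem_wired h.symm with h' | ⟨b, hb, hvb⟩
  · exact Or.inl h'.symm
  · exact Or.inr ⟨b, hb, hvb.symm⟩

/-- **The ghost correction is an arm event**: if two probe sets are joined through the wiring but
not by an open path, then the first probe set is joined to the wired set by an open path.
[folklore] -/
theorem exists_siteArm_of_ghostConn {A A' : Set W}
    (hg : ∃ x y : W, x ∈ A ∧ y ∈ A' ∧ (openGraph ω ⊔ wired B).Reachable x y)
    (hn : ¬ ∃ x y : W, x ∈ A ∧ y ∈ A' ∧ (openGraph ω).Reachable x y) :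
    ∃ x ∈ A, ∃ b ∈ B, (openGraph ω).Reachable x b := by
  obtain ⟨x, y, hx, hy, hxy⟩ := hg
  rcases reachable_or_exists_mem_wired hxy with h | ⟨b, hb, hxb⟩
  · exact absurd ⟨x, y, hx, hy, h⟩ hn
  · exact ⟨x, hx, b, hb, hxb⟩

/-- … and the first probe set cannot contain the wired set (else the last wired vertex of the
path is a probe vertex joined to the second probe by an open path). [folklore] -/
theorem not_wired_subset_of_ghostConn {A A' : Set W}
    (hg : ∃ x y : W, x ∈ A ∧ y ∈ A' ∧ (openGraph ω ⊔ wired B).Reachable x y)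
    (hn : ¬ ∃ x y : W, x ∈ A ∧ y ∈ A' ∧ (openGraph ω).Reachable x y) (hB : B ⊆ A) : False := by
  obtain ⟨x, y, hx, hy, hxy⟩ := hg
  rcases reachable_or_exists_mem_wired' hxy with h | ⟨b, hb, hby⟩
  · exact hn ⟨x, y, hx, hy, h⟩
  · exact hn ⟨b, y, hB hb, hy, hby⟩

end Wiring

/-! ### Translated boxes: the ghost correction is a union of arm events of points of `Λ_r` -/

section ThermoLimit

variable {d : ℕ}

/-- The wired random-cluster measure `φ¹_{S,p,q}` of the finite piece `S` of `ℤ^d`. -/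
local notation "μ[" p ", " q "](" S ")" =>
  rcMeasure (finsetGraph (zdGraph _) S) p q (wiredBoundary (zdGraph _) S)

/-- The translated box `Λ_L + v = ∏ᵢ [-L + vᵢ, L + vᵢ]`. -/
local notation "Λ⟦" v ", " L "⟧" =>
  Finset.Icc (fun i => -((L : ℕ) : ℤ) + (v : Site _) i) (fun i => ((L : ℕ) : ℤ) + (v : Site _) i)

-- `quotPrecheck` cannot check the binder syntax `∀ ij ∈ T, …` / projections inside these
-- notation bodies; the notations are file-local abbreviations of fully explicit terms.
set_option quotPrecheck false in
/-- The ghost-wired connection event of the index pairs `T` among the probes `K` in the piece `S`. -/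
local notation "GE⟦" S ", " K ", " T "⟧" =>
  setOf fun ω : BondConfig ↥S => ∀ ij ∈ (T : Finset (Fin _ × Fin _)), ∃ x y : ↥S,
    x.1 ∈ (K : Fin _ → Set (Site _)) ij.1 ∧ y.1 ∈ K ij.2 ∧
    (openGraph ω ⊔ wired (wiredBoundary (zdGraph _) S)).Reachable x y

set_option quotPrecheck false in
/-- The open-path connection event of the index pairs `T` among the probes `K` in the piece `S`. -/
local notation "CE⟦" S ", " K ", " T "⟧" =>
  setOf fun ω : BondConfig ↥S => ∀ ij ∈ (T : Finset (Fin _ × Fin _)), ∃ x y : ↥S,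
    x.1 ∈ (K : Fin _ → Set (Site _)) ij.1 ∧ y.1 ∈ K ij.2 ∧ (openGraph ω).Reachable x y

set_option quotPrecheck false in
/-- The atom: the pairs of `S₀` are connected by open paths, the pairs of `T` are not. -/
local notation "AT⟦" S ", " K ", " S₀ ", " T "⟧" =>
  setOf fun ω : BondConfig ↥S => (∀ ij ∈ (S₀ : Finset (Fin _ × Fin _)), ∃ x y : ↥S,
      x.1 ∈ (K : Fin _ → Set (Site _)) ij.1 ∧ y.1 ∈ K ij.2 ∧ (openGraph ω).Reachable x y) ∧
    ∀ ij ∈ (T : Finset (Fin _ × Fin _)), ¬ ∃ x y : ↥S,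
      x.1 ∈ K ij.1 ∧ y.1 ∈ K ij.2 ∧ (openGraph ω).Reachable x y

set_option quotPrecheck false in
/-- The arm event: the lattice point `x` is joined to `∂S` by an open path of `S`. -/
local notation "AE⟦" S ", " x "⟧" =>
  setOf fun ω : BondConfig ↥S => ∃ a y : ↥S, a.1 = (x : Site _) ∧
    y ∈ wiredBoundary (zdGraph _) S ∧ (openGraph ω).Reachable a y

/-- The inner boundary of a large translated box `Λ_L + v` (`L > r + ‖v‖`) avoids `Λ_r`: a boundary
vertex has an extremal coordinate `±L + vᵢ`. [folklore] -/
theorem notMem_box_of_mem_wiredBoundary_icc_shift {v : Site d} {L r : ℕ} (hL : r + siteRad v < L)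
    {b : ↥Λ⟦v, L⟧} (hb : b ∈ wiredBoundary (zdGraph d) Λ⟦v, L⟧) : b.1 ∉ box d r := by
  intro hbr
  rw [mem_wiredBoundary_iff, mem_innerBoundary_iff] at hb
  obtain ⟨hbS, y, hyS, hadj⟩ := hb
  rw [mem_siteIcc_iff] at hbS
  rw [mem_siteIcc_iff, not_forall] at hyS
  obtain ⟨j, hj⟩ := hyS
  rw [mem_box] at hbr
  have hvj := natAbs_apply_le_siteRad v j
  have hbj := hbS j
  have hrj := hbr j
  rcases (zdGraph_adj_iff _ _).1 hadj with ⟨i, hy | hy⟩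
  · have hyj : y j = b.1 j + (Pi.single i (1 : ℤ) : Site d) j := by rw [hy, Pi.add_apply]
    by_cases hji : j = i
    · subst hji; rw [Pi.single_eq_same] at hyj; omega
    · rw [Pi.single_eq_of_ne hji, add_zero] at hyj; omega
  · have hyj : b.1 j = y j + (Pi.single i (1 : ℤ) : Site d) j := by rw [hy, Pi.add_apply]
    by_cases hji : j = i
    · subst hji; rw [Pi.single_eq_same] at hyj; omega
    · rw [Pi.single_eq_of_ne hji, add_zero] at hyj; omega

/-- **The ghost correction is a finite union of arm events** (the event inclusion of Grimmett 2006,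
Thm. (4.19)(c) pattern, for the wired measure): in `Λ_L + v` with `L > r + ‖v‖`, if every pair of
`T` is joined through the wiring but some pair is not joined by an open path, then some lattice
point of `Λ_r` is joined to `∂(Λ_L + v)` by an open path — a finite probe lies in `Λ_r`, and a
co-finite probe contains `∂(Λ_L + v)`. [cite: Grimmett2006, Thm. (4.19), proof] -/
theorem ghostConnEvent_diff_connEvent_subset {m : ℕ} {K : Fin m → Set (Site d)} {r : ℕ}
    (hr : ∀ i, K i ⊆ ↑(box d r) ∨ (K i)ᶜ ⊆ ↑(box d r)) (v : Site d) {L : ℕ}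
    (hL : r + siteRad v < L) (T : Finset (Fin m × Fin m)) :
    GE⟦Λ⟦v, L⟧, K, T⟧ \ CE⟦Λ⟦v, L⟧, K, T⟧ ⊆ ⋃ x ∈ box d r, AE⟦Λ⟦v, L⟧, x⟧ := by
  rintro ω ⟨hg, hn⟩
  simp only [Set.mem_setOf_eq, not_forall] at hn
  obtain ⟨ij, hij, hn⟩ := hn
  have hg' := hg ij hij
  rcases hr ij.1 with hfin | hcof
  · obtain ⟨x, hx, b, hb, hxb⟩ := exists_siteArm_of_ghostConn (A := {x : ↥Λ⟦v, L⟧ | x.1 ∈ K ij.1})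
      (A' := {y : ↥Λ⟦v, L⟧ | y.1 ∈ K ij.2}) hg' hn
    exact Set.mem_iUnion₂.2 ⟨x.1, hfin hx, x, b, rfl, hb, hxb⟩
  · refine (not_wired_subset_of_ghostConn (A := {x : ↥Λ⟦v, L⟧ | x.1 ∈ K ij.1})
      (A' := {y : ↥Λ⟦v, L⟧ | y.1 ∈ K ij.2}) hg' hn fun b hb => ?_).elim
    by_contra hbK
    exact notMem_box_of_mem_wiredBoundary_icc_shift hL hb (hcof hbK)

/-- Open-path connection events are contained in the ghost-wired ones. [folklore] -/
theorem connEvent_subset_ghostConnEvent (S : Finset (Site d)) {m : ℕ} (K : Fin m → Set (Site d))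
    (T : Finset (Fin m × Fin m)) : CE⟦S, K, T⟧ ⊆ GE⟦S, K, T⟧ := fun ω hω ij hij => by
  obtain ⟨x, y, hx, hy, hxy⟩ := hω ij hij
  exact ⟨x, y, hx, hy, hxy.mono le_sup_left⟩

/-! ### Convergence of the connection events, of the atoms, of the law of the relation -/

/-- **The open-path connection events converge along translated boxes** (`p = 1 - e^{-2β_c(d)}`,
`q = 2`, `d ≥ 3`): the ghost-wired probabilities converge to a `v`-independent limit (`RandomClusterGhostConnection`)
and the ghost correction is at most `∑_{x ∈ Λ_r} φ¹_{Λ_L+v}(x ↔ ∂) → 0` (`CriticalFKIsingArmVanishes`).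
[cite: Grimmett2006, Thm. (4.19), proof] -/
theorem tendsto_rcMeasure_real_connEvent_criticalBeta (hd : 3 ≤ d) {m : ℕ} {K : Fin m → Set (Site d)}
    (hK : ∀ i, (K i).Finite ∨ (K i)ᶜ.Finite) (T : Finset (Fin m × Fin m)) :
    ∃ ℓ : ℝ, ∀ v : Site d, Tendsto (fun L : ℕ =>
      (μ[fkIsingParam (criticalBeta d), 2](Λ⟦v, L⟧)).real CE⟦Λ⟦v, L⟧, K, T⟧) atTop (𝓝 ℓ) := by
  have hd0 : 0 < d := by omega
  have hp : fkIsingParam (criticalBeta d) ∈ Set.Icc (0 : ℝ) 1 :=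
    fkIsingParam_mem_Icc (criticalBeta_nonneg d)
  obtain ⟨ℓ, hℓ⟩ := tendsto_rcMeasure_real_ghostConnEvent hd0 hp one_le_two hK T
  obtain ⟨r, hr⟩ := exists_probeRadius hK
  refine ⟨ℓ, fun v => ?_⟩
  -- the ghost correction vanishes
  have hdiff : Tendsto (fun L : ℕ => (μ[fkIsingParam (criticalBeta d), 2](Λ⟦v, L⟧)).real
      (GE⟦Λ⟦v, L⟧, K, T⟧ \ CE⟦Λ⟦v, L⟧, K, T⟧)) atTop (𝓝 0) := by
    have hsum : Tendsto (fun L : ℕ => ∑ x ∈ box d r,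
        (μ[fkIsingParam (criticalBeta d), 2](Λ⟦v, L⟧)).real AE⟦Λ⟦v, L⟧, x⟧) atTop (𝓝 0) := by
      have h := tendsto_finsetSum (box d r) fun x (_ : x ∈ box d r) => tendsto_rcMeasure_real_siteArm_criticalBeta hd v x
      simp only [Finset.sum_const_zero] at h
      exact h
    refine squeeze_zero' (Eventually.of_forall fun L => measureReal_nonneg) ?_ hsum
    filter_upwards [eventually_gt_atTop (r + siteRad v)] with L hL
    haveI : IsProbabilityMeasure (μ[fkIsingParam (criticalBeta d), 2](Λ⟦v, L⟧)) :=
      isProbabilityMeasure_rcMeasure _ hp two_pos _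
    exact (measureReal_mono (ghostConnEvent_diff_connEvent_subset hr v hL T) (measure_ne_top _ _)).trans
      (measureReal_biUnion_finset_le _ _)
  -- `φ(open event) = φ(ghost event) - φ(ghost ∖ open)`
  have hkey : ∀ L : ℕ, (μ[fkIsingParam (criticalBeta d), 2](Λ⟦v, L⟧)).real CE⟦Λ⟦v, L⟧, K, T⟧ =
      (μ[fkIsingParam (criticalBeta d), 2](Λ⟦v, L⟧)).real GE⟦Λ⟦v, L⟧, K, T⟧ -
        (μ[fkIsingParam (criticalBeta d), 2](Λ⟦v, L⟧)).real
          (GE⟦Λ⟦v, L⟧, K, T⟧ \ CE⟦Λ⟦v, L⟧, K, T⟧) := by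
    intro L
    haveI : IsProbabilityMeasure (μ[fkIsingParam (criticalBeta d), 2](Λ⟦v, L⟧)) :=
      isProbabilityMeasure_rcMeasure _ hp two_pos _
    have h1 := measureReal_inter_add_sdiff (μ := μ[fkIsingParam (criticalBeta d), 2](Λ⟦v, L⟧))
      (s := GE⟦Λ⟦v, L⟧, K, T⟧) (t := CE⟦Λ⟦v, L⟧, K, T⟧) (Set.toFinite _).measurableSet
    rw [Set.inter_eq_right.2 (connEvent_subset_ghostConnEvent _ K T)] at h1
    linarith
  rw [show (fun L : ℕ => (μ[fkIsingParam (criticalBeta d), 2](Λ⟦v, L⟧)).real CE⟦Λ⟦v, L⟧, K, T⟧) =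
      fun L : ℕ => (μ[fkIsingParam (criticalBeta d), 2](Λ⟦v, L⟧)).real GE⟦Λ⟦v, L⟧, K, T⟧ -
        (μ[fkIsingParam (criticalBeta d), 2](Λ⟦v, L⟧)).real
          (GE⟦Λ⟦v, L⟧, K, T⟧ \ CE⟦Λ⟦v, L⟧, K, T⟧) from funext hkey]
  have h := (hℓ v).sub hdiff
  rw [sub_zero] at h
  exact h

/-- **The atoms converge**: for all finite sets `S₀, T` of index pairs, the probability that every
pair of `S₀` is joined by an open path and no pair of `T` is converges along `Λ_L + v`, to a
`v`-independent limit (induction on `T`: `φ(A ∖ C) = φ(A) - φ(A ∩ C)`). [cite: Grimmett2006, Thm. (4.19), proof] -/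
theorem tendsto_rcMeasure_real_connAtom_criticalBeta (hd : 3 ≤ d) {m : ℕ} {K : Fin m → Set (Site d)}
    (hK : ∀ i, (K i).Finite ∨ (K i)ᶜ.Finite) (T : Finset (Fin m × Fin m)) :
    ∀ S₀ : Finset (Fin m × Fin m), ∃ ℓ : ℝ, ∀ v : Site d, Tendsto (fun L : ℕ =>
      (μ[fkIsingParam (criticalBeta d), 2](Λ⟦v, L⟧)).real AT⟦Λ⟦v, L⟧, K, S₀, T⟧) atTop (𝓝 ℓ) := by
  have hp : fkIsingParam (criticalBeta d) ∈ Set.Icc (0 : ℝ) 1 :=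
    fkIsingParam_mem_Icc (criticalBeta_nonneg d)
  induction T using Finset.induction_on with
  | empty =>
    intro S₀
    obtain ⟨ℓ, hℓ⟩ := tendsto_rcMeasure_real_connEvent_criticalBeta hd hK S₀
    refine ⟨ℓ, fun v => (hℓ v).congr fun L => congrArg _ (Set.ext fun ω => ?_)⟩
    exact ⟨fun h => ⟨h, fun ij hij => absurd hij (Finset.notMem_empty ij)⟩, fun h => h.1⟩
  | insert ij T hij ih =>
    intro S₀
    obtain ⟨ℓ₁, h₁⟩ := ih S₀
    obtain ⟨ℓ₂, h₂⟩ := ih (insert ij S₀)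
    refine ⟨ℓ₁ - ℓ₂, fun v => ((h₁ v).sub (h₂ v)).congr fun L => ?_⟩
    haveI : IsProbabilityMeasure (μ[fkIsingParam (criticalBeta d), 2](Λ⟦v, L⟧)) :=
      isProbabilityMeasure_rcMeasure _ hp two_pos _
    have hkey := measureReal_inter_add_sdiff (μ := μ[fkIsingParam (criticalBeta d), 2](Λ⟦v, L⟧))
      (s := AT⟦Λ⟦v, L⟧, K, S₀, T⟧)
      (t := {ω : BondConfig ↥Λ⟦v, L⟧ | ∃ x y : ↥Λ⟦v, L⟧,
        x.1 ∈ K ij.1 ∧ y.1 ∈ K ij.2 ∧ (openGraph ω).Reachable x y})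
      (Set.toFinite _).measurableSet
    have hinter : AT⟦Λ⟦v, L⟧, K, S₀, T⟧ ∩ {ω : BondConfig ↥Λ⟦v, L⟧ | ∃ x y : ↥Λ⟦v, L⟧,
        x.1 ∈ K ij.1 ∧ y.1 ∈ K ij.2 ∧ (openGraph ω).Reachable x y} =
        AT⟦Λ⟦v, L⟧, K, insert ij S₀, T⟧ := by
      ext ω
      simp only [Set.mem_inter_iff, Set.mem_setOf_eq, Finset.forall_mem_insert]
      tauto
    have hdiff : AT⟦Λ⟦v, L⟧, K, S₀, T⟧ \ {ω : BondConfig ↥Λ⟦v, L⟧ | ∃ x y : ↥Λ⟦v, L⟧,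
        x.1 ∈ K ij.1 ∧ y.1 ∈ K ij.2 ∧ (openGraph ω).Reachable x y} =
        AT⟦Λ⟦v, L⟧, K, S₀, insert ij T⟧ := by
      ext ω
      simp only [Set.mem_sdiff, Set.mem_setOf_eq, Finset.forall_mem_insert]
      tauto
    rw [hinter, hdiff] at hkey
    linarith

/-- **The law of the connection relation is a sum over its atoms**: the relation
`(i, j) ↦ (K i ↔ K j by an open path of S)` is determined, by function and propositional
extensionality, by the finite set of pairs that hold, so `{relation ∈ R}` is the disjoint union over
the admissible patterns `S₀` of the atoms `{pattern = S₀}`. [folklore] -/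
theorem measureReal_connRelLaw_eq_sum {S : Finset (Site d)} (μ : Measure (BondConfig ↥S))
    [IsFiniteMeasure μ] {m : ℕ} (K : Fin m → Set (Site d)) (R : Set (Fin m → Fin m → Prop))
    [DecidablePred fun S₀ : Finset (Fin m × Fin m) => (fun i j => ((i, j) ∈ S₀)) ∈ R] :
    μ.real {ω | (fun i j => ∃ x y : ↥S, x.1 ∈ K i ∧ y.1 ∈ K j ∧ (openGraph ω).Reachable x y) ∈ R} =
      ∑ S₀ ∈ Finset.univ.filter (fun S₀ : Finset (Fin m × Fin m) => (fun i j => ((i, j) ∈ S₀)) ∈ R),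
        μ.real AT⟦S, K, S₀, Finset.univ \ S₀⟧ := by
  classical
  -- the pattern of a configuration: the set of connected index pairs
  set f : BondConfig ↥S → Finset (Fin m × Fin m) := fun ω => Finset.univ.filter fun ij =>
    ∃ x y : ↥S, x.1 ∈ K ij.1 ∧ y.1 ∈ K ij.2 ∧ (openGraph ω).Reachable x y with hf
  have hpre : {ω | (fun i j => ∃ x y : ↥S, x.1 ∈ K i ∧ y.1 ∈ K j ∧ (openGraph ω).Reachable x y) ∈ R} =
      f ⁻¹' ↑(Finset.univ.filter fun S₀ : Finset (Fin m × Fin m) => (fun i j => ((i, j) ∈ S₀)) ∈ R) := by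
    ext ω
    have hfun : (fun i j => ((i, j) ∈ f ω)) =
        fun i j => ∃ x y : ↥S, x.1 ∈ K i ∧ y.1 ∈ K j ∧ (openGraph ω).Reachable x y := by
      funext i j
      simp only [hf, Finset.mem_filter, Finset.mem_univ, true_and]
    simp only [Set.mem_setOf_eq, Set.mem_preimage, Finset.mem_coe, Finset.mem_filter,
      Finset.mem_univ, true_and, hfun]
  have hfib : ∀ S₀ : Finset (Fin m × Fin m), f ⁻¹' {S₀} = AT⟦S, K, S₀, Finset.univ \ S₀⟧ := by
    intro S₀
    ext ω
    simp only [Set.mem_preimage, Set.mem_singleton_iff, Set.mem_setOf_eq, hf, Finset.ext_iff,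
      Finset.mem_filter, Finset.mem_univ, true_and, Finset.mem_sdiff]
    constructor
    · intro h
      exact ⟨fun ij hij => (h ij).2 hij, fun ij hij hc => hij ((h ij).1 hc)⟩
    · rintro ⟨h1, h2⟩ ij
      exact ⟨fun hc => by_contra fun hij => h2 ij hij hc, h1 ij⟩
  rw [hpre, ← sum_measureReal_preimage_singleton _ (fun S₀ _ => (Set.toFinite _).measurableSet)]
  exact Finset.sum_congr rfl fun S₀ _ => by rw [hfib]

/-- **Thermodynamic limit of the connection laws along translated boxes** (the wired,
critical, `d ≥ 3` instance of Grimmett 2006, Thm. (4.19)(b)–(c) for connection events): for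
`p = 1 - e^{-2β_c(d)}`, `q = 2`, `d ≥ 3`, probes `K i` each finite or co-finite and every set `R` of
relations, there is `ℓ` such that for every `v ∈ ℤ^d` the `φ¹_{Λ_L + v}`-probability that the
open-path connection relation among the probes lies in `R` tends to `ℓ` as `L → ∞`.
[cite: Grimmett2006, Thm. (4.19), proof] -/
theorem tendsto_rcMeasure_real_connRelLaw_criticalBeta (hd : 3 ≤ d) {m : ℕ} {K : Fin m → Set (Site d)}
    (hK : ∀ i, (K i).Finite ∨ (K i)ᶜ.Finite) (R : Set (Fin m → Fin m → Prop)) :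
    ∃ ℓ : ℝ, ∀ v : Site d, Tendsto (fun L : ℕ =>
      (μ[fkIsingParam (criticalBeta d), 2](Λ⟦v, L⟧)).real
        {ω | (fun i j => ∃ x y : ↥Λ⟦v, L⟧, x.1 ∈ K i ∧ y.1 ∈ K j ∧
          (openGraph ω).Reachable x y) ∈ R}) atTop (𝓝 ℓ) := by
  classical
  have hp : fkIsingParam (criticalBeta d) ∈ Set.Icc (0 : ℝ) 1 :=
    fkIsingParam_mem_Icc (criticalBeta_nonneg d)
  have hatom := fun S₀ : Finset (Fin m × Fin m) => tendsto_rcMeasure_real_connAtom_criticalBeta hd hK (Finset.univ \ S₀) S₀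
  choose ℓ hℓ using hatom
  refine ⟨∑ S₀ ∈ Finset.univ.filter (fun S₀ : Finset (Fin m × Fin m) =>
    (fun i j => ((i, j) ∈ S₀)) ∈ R), ℓ S₀, fun v => ?_⟩
  refine (tendsto_finsetSum _ fun S₀ _ => hℓ S₀ v).congr fun L => ?_
  haveI : IsProbabilityMeasure (μ[fkIsingParam (criticalBeta d), 2](Λ⟦v, L⟧)) :=
    isProbabilityMeasure_rcMeasure _ hp two_pos _
  exact (measureReal_connRelLaw_eq_sum _ K R).symm

end ThermoLimit

end Literature.Probability.LatticeModels

end
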